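import Mathlib
import Literature.Computability.Complexity.FormulaComposition
import HarnessLib

/-!
# Route FifoMatching — crux `NNNotVP` (stmt-ValiantsHypothesis-11615), line `division_split`:
# straight-line circuit bookkeeping for the Boolean shadow over `{∧₂, ∨₂}`

Small facts about the tree's straight-line Boolean circuits
(`Literature.Computability.Complexity.Circuit`, `CircuitComposition`, `FormulaComposition`) used by
the companion `…SupportFnMonotoneBasis` (constants-free Boolean shadow of a monotone arithmetic
circuit): a circuit is a `CktSize` realization of its own size; the iterated conjunction /
disjunction of `k + 1` inputs has `k` gates; wires into a constant value list carry the constant.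

Honest framing: bookkeeping only; nothing here bears on the OPEN stubs of the line, the crux
`NNNotVP`, or `VP ≠ VNP` (NOT proved).  No definitions, no named facts.
-/

noncomputable section

-- Sub = Summit single-conjunct layout: the duplicated namespace component is mandated by the tree.
set_option linter.dupNamespace false

namespace Summit.ValiantsHypothesis.ValiantsHypothesis.Theorems.FifoMatching.NNNotVP.DivisionSplit

open Literature.Computability.Complexity
open Literature.Computability.Complexity.GateList

/-! ### Circuit bookkeeping -/

/-- A single-output circuit is a realization of size `C.size`. [folklore] -/
theorem cktSize_of_circuit {ι : Type*} {B : Set GateFn} (C : Circuit ι) (hC : C.IsOver B) :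
    CktSize B (fun (x : ι → Bool) (_ : Unit) => C.eval x) C.size := by
  refine ⟨C.gates, fun _ => C.output, le_rfl,
    ⟨wf_gates C, hC, fun _ m hm => C.wf_output m hm, fun x _ => ?_⟩⟩
  show wireOf x (vals C.gates x) C.output = C.eval x
  rw [← circuit_wireVals]
  unfold Circuit.eval
  rcases C.output with i | m <;> rfl

/-- The iterated conjunction of `k + 1` input variables has `k` gates. [folklore] -/
theorem size_bigAnd_input {ι : Type*} :
    ∀ (k : ℕ) (e : Fin (k + 1) → ι), (Circuit.bigAnd k fun i => Circuit.input (e i)).size = k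
  | 0, e => by simp [Circuit.bigAnd]
  | k + 1, e => by
    rw [Circuit.bigAnd, Circuit.size_binop, Circuit.size_input, size_bigAnd_input k (fun i => e i.succ)]
    omega

/-- The iterated disjunction of `k + 1` input variables has `k` gates. [folklore] -/
theorem size_bigOr_input {ι : Type*} :
    ∀ (k : ℕ) (e : Fin (k + 1) → ι), (Circuit.bigOr k fun i => Circuit.input (e i)).size = k
  | 0, e => by simp [Circuit.bigOr]
  | k + 1, e => by
    rw [Circuit.bigOr, Circuit.size_binop, Circuit.size_input, size_bigOr_input k (fun i => e i.succ)]
    omega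

/-- In a list of `n` copies of `c`, a wire into the first `n` gates (or an input of value `c`)
carries `c`. [folklore] -/
theorem wireOf_const_replicate {ι : Type*} (c : Bool) (n : ℕ) (w : ι ⊕ ℕ)
    (hw : ∀ m, w = .inr m → m < n) : wireOf (fun _ : ι => c) (List.replicate n c) w = c := by
  rcases w with i | m
  · rfl
  · rw [wireOf_inr]
    exact List.getD_replicate (x := c) (h := hw m rfl)

end Summit.ValiantsHypothesis.ValiantsHypothesis.Theorems.FifoMatching.NNNotVP.DivisionSplit

end
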